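import Mathlib
import Literature.NumberTheory.EllipticCurves.IwasawaAlgebra
import Literature.NumberTheory.EllipticCurves.PAdicBSD
import Literature.NumberTheory.EllipticCurves.GreenbergVatsal2000.CongruentCurves

/-!
# Sketch — crux-ideate seat 1, round 2 (stmt-BirchSwinnertonDyer-19875), card `sharpflat-zeta-element-at-three`

FL3 `constantAbsorption`: the algebraic glue behind the round-2 answer to falsifier F1.
A Beilinson–Flach engine run with Büyükboduk–Lei's integrality constant `c = p^s` (BL21 Thm 3.7,
CCSS18 §3.1 "fix c so that c·BF^• ∈ H¹(K,T)") proves only `C(p^s) · gen ∈ (L^•)`; if the colour has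
`μ(L^•) = 0` (x8 THEOREM B, `oneColourMuAn`), the constant is absorbed in `Λ = ℤ_p⟦T⟧` because
`(p) = augIdealP` is prime (`Λ/(p) = 𝔽_p⟦T⟧` is a domain): `p^s · gen = L^• · h₁ ∧ p ∤ L^• ⇒ L^• ∣ gen`.
-/

open Literature.NumberTheory.EllipticCurves Literature.NumberTheory.EllipticCurves.GreenbergVatsal2000

namespace Summit.BirchSwinnertonDyer.BirchSwinnertonDyer.Cruxes.SprungLowerDivisibilityAtThree.SharpflatZetaElementAtThree

variable {p : ℕ} [Fact p.Prime]

/-- Reduction of coefficients modulo `p`: `Λ = ℤ_p⟦T⟧ → 𝔽_p⟦T⟧`. -/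
noncomputable def redModP (p : ℕ) [Fact p.Prime] : IwasawaAlgebra p →+* PowerSeries (ZMod p) :=
  PowerSeries.map PadicInt.toZMod

lemma toZMod_natCast_self : PadicInt.toZMod (p : ℤ_[p]) = 0 := by
  rw [map_natCast, ZMod.natCast_self]

/-- `F ≡ 0 (mod p)` coefficientwise iff `F ∈ (p) = augIdealP`, i.e. `μ(F) > 0`. -/
lemma redModP_eq_zero_iff (F : IwasawaAlgebra p) :
    redModP p F = 0 ↔ ∃ G : IwasawaAlgebra p, F = PowerSeries.C (p : ℤ_[p]) * G := by
  constructor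
  · intro h
    have hc : ∀ n, (p : ℤ_[p]) ∣ PowerSeries.coeff n F := by
      intro n
      have hn := congrArg (PowerSeries.coeff n) h
      simp only [redModP, PowerSeries.coeff_map, map_zero] at hn
      have hk : PowerSeries.coeff n F ∈ RingHom.ker (PadicInt.toZMod : ℤ_[p] →+* ZMod p) := hn
      rwa [PadicInt.ker_toZMod, PadicInt.maximalIdeal_eq_span_p, Ideal.mem_span_singleton] at hk
    choose G hG using hc
    refine ⟨PowerSeries.mk G, ?_⟩
    ext n
    rw [PowerSeries.coeff_C_mul, PowerSeries.coeff_mk]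
    exact hG n
  · rintro ⟨G, rfl⟩
    rw [map_mul]
    have hC : redModP p (PowerSeries.C (p : ℤ_[p])) = 0 := by
      rw [redModP, PowerSeries.map_C, toZMod_natCast_self, map_zero]
    rw [hC, zero_mul]

lemma mem_augIdealP_iff (F : IwasawaAlgebra p) :
    F ∈ IwasawaAlgebra.augIdealP p ↔ ∃ G : IwasawaAlgebra p, F = PowerSeries.C (p : ℤ_[p]) * G := by
  rw [IwasawaAlgebra.augIdealP, Ideal.mem_span_singleton]
  rfl

lemma C_natCast_ne_zero : (PowerSeries.C (p : ℤ_[p]) : IwasawaAlgebra p) ≠ 0 := by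
  intro h0
  have h1 := congrArg PowerSeries.constantCoeff h0
  simp only [PowerSeries.constantCoeff_C, map_zero] at h1
  exact (Nat.cast_ne_zero.mpr (Fact.out : p.Prime).ne_zero) h1

/-- **FL3 (constant absorption; PROVED).** In `Λ = ℤ_p⟦T⟧`: if `μ(L) = 0` (`L ∉ (p)`) and
`p^s · g = L · h₁`, then `L ∣ g`. This is the glue that turns a Beilinson–Flach lower bound carrying
Büyükboduk–Lei's integrality constant `c = p^s` into the EXACT lower divisibility the crux asks for,
on the colour where x8 THEOREM B gives `μ = 0`. -/
theorem constantAbsorption (s : ℕ) (L g h₁ : IwasawaAlgebra p)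
    (hμ : L ∉ IwasawaAlgebra.augIdealP p)
    (h : PowerSeries.C ((p : ℤ_[p]) ^ s) * g = L * h₁) :
    ∃ h : IwasawaAlgebra p, g = L * h := by
  induction s generalizing h₁ with
  | zero => exact ⟨h₁, by simpa using h⟩
  | succ s ih =>
    have hred : redModP p L * redModP p h₁ = 0 := by
      rw [← map_mul, ← h, map_mul]
      have hz : redModP p (PowerSeries.C ((p : ℤ_[p]) ^ (s + 1))) = 0 := by
        rw [redModP_eq_zero_iff]
        exact ⟨PowerSeries.C ((p : ℤ_[p]) ^ s), by rw [← map_mul, ← pow_succ']⟩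
      rw [hz, zero_mul]
    rcases mul_eq_zero.mp hred with hL0 | hh0
    · exact absurd ((mem_augIdealP_iff L).mpr ((redModP_eq_zero_iff L).mp hL0)) hμ
    · obtain ⟨h₂, rfl⟩ := (redModP_eq_zero_iff h₁).mp hh0
      have key : PowerSeries.C (p : ℤ_[p]) * (PowerSeries.C ((p : ℤ_[p]) ^ s) * g)
          = PowerSeries.C (p : ℤ_[p]) * (L * h₂) := by
        rw [← mul_assoc, ← map_mul, ← pow_succ', h]; ring
      exact ih h₂ (mul_left_cancel₀ C_natCast_ne_zero key)

/-- **FL3′ (crux currency).** The same absorption seen through `ι : Λ ↪ ℚ_p⟦T⟧`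
(`iwasawaToPowerSeries`, injective): a `c`-lower bound `ι(p^s · gen) = ι(L^• · h₁)` with `μ(L^•) = 0`
yields `ι gen = ι(L^• · h)` for some `h ∈ Λ` — the shape of the conclusion of
`Theorems.SprungSharpFlatLowerDivisibility` (there with the period ratio `C ϖ` in front). -/
theorem constantAbsorption_iota (s : ℕ) (L gen h₁ : IwasawaAlgebra p)
    (hμ : L ∉ IwasawaAlgebra.augIdealP p)
    (h : iwasawaToPowerSeries p (PowerSeries.C ((p : ℤ_[p]) ^ s) * gen)
        = iwasawaToPowerSeries p (L * h₁)) :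
    ∃ h : IwasawaAlgebra p, iwasawaToPowerSeries p gen = iwasawaToPowerSeries p (L * h) := by
  obtain ⟨h', hh'⟩ := constantAbsorption s L gen h₁ hμ (iwasawaToPowerSeries_injective p h)
  exact ⟨h', by rw [hh']⟩


/-- Unit content (`HasUnitContent`, the currency of x8 THEOREM B `ClassX8.oneColourMuAn` /
`ClassX8.oneColour_unitContent`) implies `μ = 0` in the ideal-theoretic form used above. -/
lemma not_mem_augIdealP_of_hasUnitContent (L : IwasawaAlgebra p) (hL : HasUnitContent L) :
    L ∉ IwasawaAlgebra.augIdealP p := by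
  intro hmem
  obtain ⟨G, rfl⟩ := (mem_augIdealP_iff _).mp hmem
  obtain ⟨n, hn⟩ := hL
  rw [PowerSeries.coeff_C_mul] at hn
  have hp : IsUnit (p : ℤ_[p]) := isUnit_of_mul_isUnit_left hn
  exact (PadicInt.irreducible_p (p := p)).1 hp

/-- **FL3″ (the form the line consumes).** A Beilinson–Flach lower bound carrying the constant
`c = p^s` for a colour of UNIT CONTENT (x8 THEOREM B supplies one such colour on every X8 pair,
hypothesis-free) is already the exact lower divisibility `ι gen = ι(L^• · h)`. -/
theorem constantAbsorption_of_hasUnitContent (s : ℕ) (L gen h₁ : IwasawaAlgebra p)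
    (hL : HasUnitContent L)
    (h : iwasawaToPowerSeries p (PowerSeries.C ((p : ℤ_[p]) ^ s) * gen)
        = iwasawaToPowerSeries p (L * h₁)) :
    ∃ h : IwasawaAlgebra p, iwasawaToPowerSeries p gen = iwasawaToPowerSeries p (L * h) :=
  constantAbsorption_iota s L gen h₁ (not_mem_augIdealP_of_hasUnitContent L hL) h

end Summit.BirchSwinnertonDyer.BirchSwinnertonDyer.Cruxes.SprungLowerDivisibilityAtThree.SharpflatZetaElementAtThree
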